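import Mathlib

/-!
# Negative-side lemmas for the crux `EntropyRung.SubcylindricalExistence` (stmt-SmoothPoincare4-10871):
# the entropy window, certified

Decimal certificates for the three Gaussian-density logarithms that govern the crux and its rung
(Cao–Hamilton–Ilmanen 2004, §4 table): `ν_cyl = log Θ(S³×ℝ) = log 2 + ½ log π − 3/2`,
`ν_round = log Θ(S⁴) = log 6 − 2`, `ν_sheet = log Θ(S²×ℝ²) = log 2 − 1`:
* `nuCyl_lt_nuRound` (`⇔ πe < 9`): the round sphere clears the cylinder threshold;
* `margin_gt` / `margin_lt`: `0.026 < ν_round − ν_cyl < 0.0263` — the round witness works with `δ = 0.026` and with no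
  `δ ≥ 0.0263`;
* `nuSheet_lt_nuCyl`, `nuCyl_sub_nuSheet_gt`: `ν_sheet < ν_cyl − 0.072` — a PSC metric with a large `S²(ρ)×D²` region is
  no witness (cdisprove record `Disproof.lean`, §5);
* `neckProfile_ge`, `sheetProfile_ge`: the closed-form Gaussian profiles `ν_cyl + (3/2)(y − 1 − log y)`,
  `ν_sheet + (x − 1 − log x)` are minimal at the shrinker scale.
Tools: `Real.pi_gt_d6/lt_d6`, `Real.exp_one_gt_d9/lt_d9`, `Real.exp_bound` (4th-order Taylor), `Real.quadratic_le_exp_of_nonneg`.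
[folklore]
-/

noncomputable section

namespace Summit.SmoothPoincare4.Cruxes.SubcylindricalExistence.Negative

/-- `ν_round − ν_cyl = log 3 − ½ log π − ½ = ½ log (9/(πe))`. -/
theorem nuRound_sub_nuCyl : (Real.log 6 - 2) - (Real.log 2 + Real.log Real.pi / 2 - 3 / 2) = Real.log 3 - Real.log Real.pi / 2 - 1 / 2 := by
  have h6 : Real.log 6 = Real.log 2 + Real.log 3 := by
    rw [show (6 : ℝ) = 2 * 3 by norm_num, Real.log_mul (by norm_num) (by norm_num)]
  rw [h6]
  ring

/-- **The round sphere clears the cylinder** (`Θ(S⁴) = .812 > Θ(S³×ℝ) = .791`): `ν_cyl < ν_round`,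
equivalently `π·e < 9`.  Uses `π < 3.15`, `e < 2.7182818286`. -/
theorem nuCyl_lt_nuRound : (Real.log 2 + Real.log Real.pi / 2 - 3 / 2) < (Real.log 6 - 2) := by
  have h1 : Real.log Real.pi < Real.log 3.15 := Real.log_lt_log Real.pi_pos Real.pi_lt_d2
  have h2 : Real.log 3.15 + 1 < 2 * Real.log 3 := by
    have hprod : (3.15 : ℝ) * Real.exp 1 < 9 := by
      have := Real.exp_one_lt_d9; nlinarith
    have h := Real.log_lt_log (by positivity) hprod
    rw [Real.log_mul (by norm_num) (Real.exp_pos 1).ne', Real.log_exp,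
      show (9 : ℝ) = 3 ^ 2 by norm_num, Real.log_pow] at h
    push_cast at h
    linarith
  have h3 := nuRound_sub_nuCyl
  linarith

/-- **The bubble sheet sits below the cylinder** (`Θ(S²×ℝ²) = 2/e = .736 < .791`): `log 2 − 1 < ν_cyl`,
equivalently `e < π`.  This is the inequality behind the cycle-2 finding of §5: a PSC metric containing a
large `S²(ρ)×D²` region has `ν ≤ log 2 − 1 + o(1) < ν_cyl − 0.072`. -/
theorem nuSheet_lt_nuCyl : (Real.log 2 - 1) < (Real.log 2 + Real.log Real.pi / 2 - 3 / 2) := by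
  have h1 : Real.exp 1 < Real.pi := by
    have := Real.exp_one_lt_d9; have := Real.pi_gt_d2; linarith
  have h2 : (1 : ℝ) < Real.log Real.pi := by
    have h := Real.log_lt_log (Real.exp_pos 1) h1
    rwa [Real.log_exp] at h
  linarith

/-- Fourth-order Taylor upper bound for `exp` on `[0,1]` (from Mathlib's `Real.exp_bound`), used for the
decimal certificates below. -/
theorem exp_le_taylor4 {x : ℝ} (hx0 : 0 ≤ x) (hx : x ≤ 1) :
    Real.exp x ≤ 1 + x + x ^ 2 / 2 + x ^ 3 / 6 + x ^ 4 * (5 / 96) := by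
  have habs : |x| ≤ 1 := by rwa [abs_of_nonneg hx0]
  have h := Real.exp_bound habs (n := 4) (by norm_num)
  have h' := (abs_sub_le_iff.1 h).1
  norm_num [Finset.sum_range_succ, Nat.factorial_succ, abs_of_nonneg hx0] at h'
  linarith

/-- `ν_cyl − (log 2 − 1) = (log π − 1)/2 > 0.072`: the bubble-sheet deficit (certificate: `e^{1.144} < π`
from `e < 2.7182818286`, the Taylor bound `e^{0.144} < 1.15489` and `π > 3.141592`). -/
theorem nuCyl_sub_nuSheet_gt : (0.072 : ℝ) < (Real.log 2 + Real.log Real.pi / 2 - 3 / 2) - (Real.log 2 - 1) := by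
  have hexp : Real.exp 1.144 < Real.pi := by
    have hT := exp_le_taylor4 (x := 0.144) (by norm_num) (by norm_num)
    have hX : Real.exp 0.144 < 1.15489 := lt_of_le_of_lt hT (by norm_num)
    have he : Real.exp 1.144 = Real.exp 1 * Real.exp 0.144 := by
      rw [← Real.exp_add]; norm_num
    have h1 : Real.exp 1 * Real.exp 0.144 < 2.7182818286 * 1.15489 :=
      mul_lt_mul'' Real.exp_one_lt_d9 hX (Real.exp_pos 1).le (Real.exp_pos _).le
    have := Real.pi_gt_d6
    rw [he]
    norm_num at h1 ⊢
    linarith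
  have hlog : (1.144 : ℝ) < Real.log Real.pi := by
    have h := Real.log_lt_log (Real.exp_pos _) hexp
    rwa [Real.log_exp] at h
  linarith

/-- **Lower margin** `0.026 < ν_round − ν_cyl` (certifies the planner's `δ = 0.026` for the round witness):
`⇔ π e^{1.052} < 9`; certificate `π < 3.141593`, `e < 2.7182818286`, Taylor `e^{0.052} < 1.05339`. -/
theorem margin_gt : (0.026 : ℝ) < (Real.log 6 - 2) - (Real.log 2 + Real.log Real.pi / 2 - 3 / 2) := by
  rw [nuRound_sub_nuCyl]
  have hprod : Real.pi * Real.exp 1.052 < 9 := by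
    have hT := exp_le_taylor4 (x := 0.052) (by norm_num) (by norm_num)
    have hX : Real.exp 0.052 < 1.05339 := lt_of_le_of_lt hT (by norm_num)
    have he : Real.exp 1.052 = Real.exp 1 * Real.exp 0.052 := by
      rw [← Real.exp_add]; norm_num
    have h1 : Real.exp 1 * Real.exp 0.052 < 2.7182818286 * 1.05339 :=
      mul_lt_mul'' Real.exp_one_lt_d9 hX (Real.exp_pos 1).le (Real.exp_pos _).le
    have h2 : Real.pi * (Real.exp 1 * Real.exp 0.052) < 3.141593 * (2.7182818286 * 1.05339) :=
      mul_lt_mul'' Real.pi_lt_d6 h1 Real.pi_pos.le (by positivity)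
    rw [he]
    norm_num at h2 ⊢
    linarith
  have hlog := Real.log_lt_log (by positivity) hprod
  rw [Real.log_mul Real.pi_pos.ne' (Real.exp_pos _).ne', Real.log_exp,
    show (9 : ℝ) = 3 ^ 2 by norm_num, Real.log_pow] at hlog
  push_cast at hlog
  linarith

/-- **Upper margin** `ν_round − ν_cyl < 0.0263`: `⇔ 9 < π e^{1.0526}`; certificate `π > 3.141592`,
`e > 2.7182818283`, `1 + x + x²/2 ≤ eˣ`.  So `0.026 < δ_max(round) < 0.0263` (value `0.0262475…`): the round
metric witnesses the crux with `δ = 0.026` and with no `δ ≥ 0.0263`. -/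
theorem margin_lt : (Real.log 6 - 2) - (Real.log 2 + Real.log Real.pi / 2 - 3 / 2) < (0.0263 : ℝ) := by
  rw [nuRound_sub_nuCyl]
  have hprod : (9 : ℝ) < Real.pi * Real.exp 1.0526 := by
    have hq : (1 : ℝ) + 0.0526 + 0.0526 ^ 2 / 2 ≤ Real.exp 0.0526 :=
      Real.quadratic_le_exp_of_nonneg (by norm_num)
    have he : Real.exp 1.0526 = Real.exp 1 * Real.exp 0.0526 := by
      rw [← Real.exp_add]; norm_num
    have hE : (2.7182818283 : ℝ) < Real.exp 1 := Real.exp_one_gt_d9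
    have hP : (3.141592 : ℝ) < Real.pi := Real.pi_gt_d6
    have h1 : (2.7182818283 : ℝ) * (1 + 0.0526 + 0.0526 ^ 2 / 2) ≤ Real.exp 1 * Real.exp 0.0526 :=
      mul_le_mul hE.le hq (by norm_num) (Real.exp_pos 1).le
    have h2 : (3.141592 : ℝ) * ((2.7182818283 : ℝ) * (1 + 0.0526 + 0.0526 ^ 2 / 2)) ≤
        Real.pi * (Real.exp 1 * Real.exp 0.0526) :=
      mul_le_mul hP.le h1 (by norm_num) Real.pi_pos.le
    rw [he]
    norm_num at h2 ⊢
    linarith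
  have hlog := Real.log_lt_log (by norm_num) hprod
  rw [Real.log_mul Real.pi_pos.ne' (Real.exp_pos _).ne', Real.log_exp,
    show (9 : ℝ) = 3 ^ 2 by norm_num, Real.log_pow] at hlog
  push_cast at hlog
  linarith

/-- **Gaussian profile on an exact neck.** On `S³(ρ)×ℝ` (`R = 6/ρ²`) the Gaussian test function
`u ∝ e^{−s²/4τ}` at scale `τ` has `𝒲 = ν_cyl + (3/2)(y − 1 − log y)`, `y = 4τ/ρ²` (direct computation:
`𝒲 = 6τ/ρ² + log(ρ³√π/4) − (3/2) log τ − 3`).  The excess `(3/2)(y − 1 − log y)` is `≥ 0` and vanishes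
exactly at the shrinker scale `τ = ρ²/4`: a long neck in a PSC metric pins `ν ≤ ν_cyl + o(1)`. -/
theorem neckProfile_ge (y : ℝ) (hy : 0 < y) :
    (Real.log 2 + Real.log Real.pi / 2 - 3 / 2) ≤ (Real.log 2 + Real.log Real.pi / 2 - 3 / 2) + 3 / 2 * (y - 1 - Real.log y) := by
  have := Real.log_le_sub_one_of_pos hy
  nlinarith

/-- **Gaussian profile on an exact bubble sheet.** On `S²(ρ)×ℝ²` (`R = 2/ρ²`) the Gaussian test function at
scale `τ` has `𝒲 = (log 2 − 1) + (x − 1 − log x)`, `x = 2τ/ρ²` (`𝒲 = 2τ/ρ² + log(ρ²/τ) − 2`), minimal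
`= log 2 − 1 = ν_sheet < ν_cyl − 0.072` at the shrinker scale `τ = ρ²/2`.  This is the computation behind
`ForallStrengthening` being false (§5). -/
theorem sheetProfile_ge (x : ℝ) (hx : 0 < x) :
    (Real.log 2 - 1) ≤ (Real.log 2 - 1) + (x - 1 - Real.log x) := by
  have := Real.log_le_sub_one_of_pos hx
  linarith


end Summit.SmoothPoincare4.Cruxes.SubcylindricalExistence.Negative

end
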